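import Mathlib
import Literature.Analysis.FluidPDE.ChoiEtAl2017PeriodicHouLuoAssembly
import HarnessLib

/-!
# Choi–Hou–Kiselev–Luo–Šverák–Yao 2017, §4: reflection symmetry of the periodic HL model, and the
# blow-up theorem conditional on UNIQUENESS (instead of symmetry persistence) and Lemma 7

HONEST FRAMING (cell ns-blowup GROUP B «PROFILE SEARCH», zones Z3-b′ / Z8 = the Hou–Luo boundary
MODEL): **1-D MODEL (Hou–Luo), not Euler/NS.** Proof-only companion of
`ChoiEtAl2017PeriodicHouLuoBlowup.lean` and `…Assembly.lean`. Source: K. Choi, T. Y. Hou,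
A. Kiselev, G. Luo, V. Šverák, Y. Yao, Comm. Pure Appl. Math. **70** (2017) 2218–2243 =
arXiv:1407.4776 [ChoiHouKiselevLuoSverakYao2017], §4 p. 11: "Thanks to transport structure of (hl),
the evolution preserves the assumptions as long as the solution exists. That is, `θ_x, ω, u` stay odd
at `x = 0` and `½L` with period `L`, `θ(0) = 0` …" — in print this uses that the HL system commutes
with the reflection `x ↦ −x` (`(ω, θ) ↦ (−ω(−x), θ(−x))`) and that smooth solutions are UNIQUE
(local well-posedness, §2 p. 6, "(bkmq)").

## What is proved (no definitions of Prop type, no named facts; net debt 0)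

* `periodicHLVelocity_reflect` — `Q[y ↦ f(−y)](x) = (Qf)(−x)` for `L`-periodic `f` (the kernel
  `log|sin μ·|` is even), and `periodicHLVelocity_neg_reflect` — `Q[y ↦ −f(−y)](x) = −(Qf)(−x)`;
* `IsPeriodicHouLuoSolution.reflect` — if `(ω, θ)` is a classical `L`-periodic HL solution on
  `[0,T)` then so is `(t,x) ↦ (−ω(t,−x), θ(t,−x))`;
* `IsGlobalSmoothPeriodicHouLuoSolution.reflect` — the same for global smooth solutions from a datum
  of the printed class (whose `ω₀` is odd and `θ₀` is even — `even_of_deriv_odd`);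
* **`not_isGlobalSmooth_of_unique_of_lemma7`** — CHKLSY Theorem 1 (periodic) for a datum of the
  class, conditional on (U) uniqueness of global smooth `L`-periodic solutions from that datum and
  (E) Lemma 7: by reflection + (U) the solution keeps the printed symmetry, and
  `not_isGlobalSmooth_of_symmetric_of_lemma7` (`…Assembly.lean`) applies. So the discharge of
  `choiEtAl2017_periodicHouLuo_blowup` is closed modulo (U) (an energy estimate needing the `L²`
  bound of `(Qω)_x`, see `…Modes.lean`) and (E).

WHAT THIS IS NOT: not Euler, not Navier–Stokes; no unconditional blow-up asserted. `violates:` none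
— MODEL.
-/

noncomputable section

open Set Filter Real MeasureTheory intervalIntegral
open _root_.Topology

namespace Literature.Analysis.FluidPDE

namespace ChoiEtAl2017

/-! ### §1 `Q` commutes with the reflection `x ↦ −x` -/

/-- **`Q[f(−·)](x) = (Qf)(−x)`** for `L`-periodic `f`: the kernel `log|sin(μ·)|` is even
(substitute `y ↦ L − y` and use periodicity). [cite: ChoiHouKiselevLuoSverakYao2017, §4 p. 11 (u = Qω; θ_x, ω, u stay odd)] -/
theorem periodicHLVelocity_reflect {L : ℝ} {f : ℝ → ℝ} (hper : Function.Periodic f L) (x : ℝ) :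
    periodicHLVelocity L (fun y => f (-y)) x = periodicHLVelocity L f (-x) := by
  unfold periodicHLVelocity
  congr 1
  have hsub : (∫ z in (0 : ℝ)..L, f (-(L - z)) * Real.log |Real.sin (π * (x - (L - z)) / L)|) =
      ∫ y in (0 : ℝ)..L, f (-y) * Real.log |Real.sin (π * (x - y) / L)| := by
    rw [intervalIntegral.integral_comp_sub_left
      (fun y => f (-y) * Real.log |Real.sin (π * (x - y) / L)|) L]
    simp
  rw [← hsub]
  refine intervalIntegral.integral_congr fun z _ => ?_
  have hf : f (-(L - z)) = f z := by
    rw [show -(L - z) = z - L by ring]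
    have h := hper (z - L)
    rw [show z - L + L = z by ring] at h
    exact h.symm
  rcases eq_or_ne L 0 with hL | hL
  · subst hL; simp
  · have h : π * (x - (L - z)) / L = -(π * (-x - z) / L) - π := by
      field_simp
      ring
    simp only [hf, h, Real.sin_sub_pi, Real.sin_neg, neg_neg]

/-- The reflected slice `x ↦ −f(−x)` of an `L`-periodic `f` is `L`-periodic. [folklore] -/
private theorem periodic_neg_reflect {f : ℝ → ℝ} {L : ℝ} (hper : Function.Periodic f L) :
    Function.Periodic (fun x => -f (-x)) L := by
  intro x
  simp only
  rw [show -(x + L) = -x - L by ring]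
  have h := hper (-x - L)
  rw [show -x - L + L = -x by ring] at h
  rw [h]

/-- The reflected slice `x ↦ f(−x)` of an `L`-periodic `f` is `L`-periodic. [folklore] -/
private theorem periodic_reflect {f : ℝ → ℝ} {L : ℝ} (hper : Function.Periodic f L) :
    Function.Periodic (fun x => f (-x)) L := by
  intro x
  simp only
  rw [show -(x + L) = -x - L by ring]
  have h := hper (-x - L)
  rw [show -x - L + L = -x by ring] at h
  rw [h]

/-- `deriv (x ↦ f(−x)) x = −f′(−x)`. [folklore] -/
private theorem deriv_reflect (f : ℝ → ℝ) (x : ℝ) :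
    deriv (fun y => f (-y)) x = -deriv f (-x) := deriv_comp_neg f x

/-- `deriv (x ↦ −f(−x)) x = f′(−x)`. [folklore] -/
private theorem deriv_neg_reflect (f : ℝ → ℝ) (x : ℝ) :
    deriv (fun y => -f (-y)) x = deriv f (-x) := by
  have h1 : deriv (-(fun y => f (-y))) x = -deriv (fun y => f (-y)) x := deriv.neg
  have h2 : (fun y => -f (-y)) = -(fun y => f (-y)) := rfl
  rw [h2, h1, deriv_reflect, neg_neg]

/-- Linearity: `Q(−f) = −Qf`. [folklore] -/
private theorem periodicHLVelocity_neg_fun (L : ℝ) (f : ℝ → ℝ) (x : ℝ) :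
    periodicHLVelocity L (fun y => -f y) x = -periodicHLVelocity L f x := by
  unfold periodicHLVelocity
  rw [← mul_neg, ← intervalIntegral.integral_neg]
  congr 1
  refine intervalIntegral.integral_congr fun y _ => ?_
  ring

/-- The reflected velocity: `Q[y ↦ −ω(−y)](x) = −(Qω)(−x)` for `L`-periodic `ω`.
[cite: ChoiHouKiselevLuoSverakYao2017, §4 p. 11 (u = Qω; θ_x, ω, u stay odd)] -/
theorem periodicHLVelocity_neg_reflect {L : ℝ} {ω : ℝ → ℝ} (hper : Function.Periodic ω L) (x : ℝ) :
    periodicHLVelocity L (fun y => -ω (-y)) x = -periodicHLVelocity L ω (-x) := by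
  rw [show (fun y => -ω (-y)) = fun y => -((fun z => ω (-z)) y) from rfl, periodicHLVelocity_neg_fun,
    periodicHLVelocity_reflect hper]

/-! ### §2 The HL system commutes with the reflection `(ω, θ) ↦ (−ω(−x), θ(−x))` -/

end ChoiEtAl2017

/-- **Reflection symmetry of the periodic HL model**: if `(ω, θ)` is a classical `L`-periodic HL
solution on `[0,T)`, so is `(t,x) ↦ (−ω(t,−x), θ(t,−x))` — the structural fact behind p. 11's
"`θ_x, ω, u` stay odd" (with uniqueness). [cite: ChoiHouKiselevLuoSverakYao2017, §4 p. 11 (the evolution preserves the odd symmetry)] -/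
theorem IsPeriodicHouLuoSolution.reflect {L T : ℝ} {ω θ : ℝ → ℝ → ℝ}
    (h : IsPeriodicHouLuoSolution L ω θ T) :
    IsPeriodicHouLuoSolution L (fun t x => -ω t (-x)) (fun t x => θ t (-x)) T := by
  obtain ⟨hslice, hcont, hderiv⟩ := h
  refine ⟨fun t ht => ?_, fun x => ?_, fun t ht x => ?_⟩
  · obtain ⟨hω, hθ, hωp, hθp⟩ := hslice t ht
    refine ⟨?_, ?_, ChoiEtAl2017.periodic_neg_reflect hωp, ChoiEtAl2017.periodic_reflect hθp⟩
    · exact (hω.comp contDiff_neg).neg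
    · exact hθ.comp contDiff_neg
  · exact ⟨((hcont (-x)).1).neg, (hcont (-x)).2⟩
  · obtain ⟨hω, hθ⟩ := hderiv t ht (-x)
    have hωp : Function.Periodic (ω t) L := (hslice t ⟨ht.1.le, ht.2⟩).2.2.1
    have hu : periodicHLVelocity L (fun y => -ω t (-y)) x = -periodicHLVelocity L (ω t) (-x) :=
      ChoiEtAl2017.periodicHLVelocity_neg_reflect hωp x
    have hdω : deriv (fun y => -ω t (-y)) x = deriv (ω t) (-x) :=
      ChoiEtAl2017.deriv_neg_reflect (ω t) x
    have hdθ : deriv (fun y => θ t (-y)) x = -deriv (θ t) (-x) :=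
      ChoiEtAl2017.deriv_reflect (θ t) x
    refine ⟨?_, ?_⟩
    · have h1 := hω.neg
      refine h1.congr_deriv ?_
      rw [hu, hdω, hdθ]
      ring
    · refine hθ.congr_deriv ?_
      rw [hu, hdθ]
      ring

namespace ChoiEtAl2017

/-- A `C¹` function with odd derivative is even. [folklore] -/
private theorem even_of_deriv_odd {g : ℝ → ℝ} (hg : ContDiff ℝ 1 g)
    (hodd : ∀ y, deriv g (-y) = -deriv g y) (x : ℝ) : g (-x) = g x := by
  have hdiff : Differentiable ℝ g := hg.differentiable (by norm_num)
  set φ : ℝ → ℝ := fun y => g y - g (-y) with hφ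
  have hφd : ∀ y, HasDerivAt φ 0 y := by
    intro y
    have h1 : HasDerivAt g (deriv g y) y := (hdiff y).hasDerivAt
    have h2 : HasDerivAt (fun z => g (-z)) (-deriv g (-y)) y := by
      have h := ((hdiff (-y)).hasDerivAt).comp y (hasDerivAt_neg y)
      refine (h.congr_of_eventuallyEq (Eventually.of_forall fun z => ?_)).congr_deriv (by ring)
      simp [Function.comp]
    have h := h1.sub h2
    refine h.congr_deriv ?_
    rw [hodd]; ring
  have hconst := is_const_of_deriv_eq_zero (fun y => (hφd y).differentiableAt) (fun y => (hφd y).deriv)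
    x 0
  simp only [hφ, neg_zero, sub_self] at hconst
  linarith

end ChoiEtAl2017

/-- **Reflection of a global smooth solution from a datum of the printed class** is again a global
smooth solution from the SAME datum (`ω₀` odd, `θ₀` even since `θ_{0x}` is odd).
[cite: ChoiHouKiselevLuoSverakYao2017, §4 p. 11 (the evolution preserves the odd symmetry)] -/
theorem IsGlobalSmoothPeriodicHouLuoSolution.reflect {L : ℝ} {ω₀ θ₀ : ℝ → ℝ} {ω θ : ℝ → ℝ → ℝ}
    (hdat : ChoiEtAl2017.IsBlowupDatum L ω₀ θ₀)
    (hsol : IsGlobalSmoothPeriodicHouLuoSolution L ω₀ θ₀ ω θ) :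
    IsGlobalSmoothPeriodicHouLuoSolution L ω₀ θ₀ (fun t x => -ω t (-x)) (fun t x => θ t (-x)) := by
  obtain ⟨hsolT, hωs, hθs, hω0, hθ0⟩ := hsol
  have hR : ContDiff ℝ (⊤ : ℕ∞) (fun p : ℝ × ℝ => (p.1, -p.2)) :=
    contDiff_fst.prodMk contDiff_snd.neg
  have hmaps : MapsTo (fun p : ℝ × ℝ => (p.1, -p.2)) {p : ℝ × ℝ | 0 ≤ p.1} {p : ℝ × ℝ | 0 ≤ p.1} :=
    fun p hp => hp
  refine ⟨fun T hT => (hsolT T hT).reflect, ?_, ?_, ?_, ?_⟩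
  · exact (hωs.comp hR.contDiffOn hmaps).neg
  · exact hθs.comp hR.contDiffOn hmaps
  · funext x
    show -ω 0 (-x) = ω₀ x
    rw [hω0, hdat.odd_ω x, neg_neg]
  · funext x
    show θ 0 (-x) = θ₀ x
    rw [hθ0]
    exact ChoiEtAl2017.even_of_deriv_odd ((contDiff_infty.1 hdat.smooth_θ) 1) (fun y => hdat.odd_dθ y) x

namespace ChoiEtAl2017

/-! ### §3 Theorem 1 (periodic), conditional on uniqueness and Lemma 7 -/

/-- **CHKLSY Theorem 1 (periodic case), conditional on (U) uniqueness and (E) Lemma 7.** For a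
datum of the printed class and a would-be global smooth `L`-periodic solution from it: IF (U) global
smooth `L`-periodic solutions from this datum are unique (in print: local well-posedness, §2 p. 6)
and (E) Lemma 7 holds for smooth odd periodic `w ≥ 0` on `[0, ½L]`, THEN `False`. By the reflection
symmetry (`IsGlobalSmoothPeriodicHouLuoSolution.reflect`) and (U) the solution keeps `ω(t)` odd
and `θ(t)` even, hence `θ_x(t)` odd, and `not_isGlobalSmooth_of_symmetric_of_lemma7` applies.
[cite: ChoiHouKiselevLuoSverakYao2017, §4 proof of Thm 1, pp. 11–13 (symmetry preserved; blow-up of I(t))] -/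
theorem not_isGlobalSmooth_of_unique_of_lemma7 {L : ℝ} {ω₀ θ₀ : ℝ → ℝ} {ω θ : ℝ → ℝ → ℝ}
    (hdat : IsBlowupDatum L ω₀ θ₀) (hsol : IsGlobalSmoothPeriodicHouLuoSolution L ω₀ θ₀ ω θ)
    (huniq : ∀ ω' θ' : ℝ → ℝ → ℝ, IsGlobalSmoothPeriodicHouLuoSolution L ω₀ θ₀ ω' θ' →
      ∀ t : ℝ, 0 ≤ t → ω' t = ω t ∧ θ' t = θ t)
    (h7 : ∀ w : ℝ → ℝ, ContDiff ℝ (⊤ : ℕ∞) w → (∀ y, w (-y) = -w y) → Function.Periodic w L →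
      (∀ y ∈ Icc 0 (L / 2), 0 ≤ w y) → ∀ a ∈ Icc 0 (L / 2),
        0 ≤ ∫ x in a..L / 2, w x * (deriv (periodicHLVelocity L w) x * Real.cot (π * x / L) -
          π / L * periodicHLVelocity L w x / Real.sin (π * x / L) ^ 2)) :
    False := by
  have href := hsol.reflect hdat
  have hsym := fun t (ht : 0 ≤ t) => huniq _ _ href t ht
  refine not_isGlobalSmooth_of_symmetric_of_lemma7 hdat hsol ?_ ?_ h7
  · intro t ht y
    have h : -ω t (-y) = ω t y := congrFun (hsym t ht).1 y
    linarith
  · intro t ht y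
    have heven : ∀ z, θ t (-z) = θ t z := fun z => congrFun (hsym t ht).2 z
    have hfun : (fun z => θ t (-z)) = θ t := funext heven
    have h1 : deriv (fun z => θ t (-z)) y = -deriv (θ t) (-y) := deriv_reflect (θ t) y
    rw [hfun] at h1
    linarith

end ChoiEtAl2017

end Literature.Analysis.FluidPDE
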